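import Literature.Geometry.Riemannian.WeightedHeatFlowCompleteDecay
import Mathlib.Analysis.Calculus.ParametricIntegral
import HarnessLib

/-!
# The weighted heat flow on a complete manifold: the entropy is continuous and dissipates at the
# rate of the Fisher information

Third layer of the proof of `bakryEmery_logSobolev_complete` from the heat-semigroup fact
`weightedHeatSemigroup_strongGradientBound_complete`: de Bruijn's identity `dH/dt = −I` on a COMPLETE
manifold (D. Bakry, I. Gentil, M. Ledoux, *Analysis and Geometry of Markov Diffusion Operators* (2014),
proof of Prop. 5.7.1, p. 268; J. A. Carrillo, L. Ni, Comm. Anal. Geom. 17 (2009), (3.2)) for a family `u`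
jointly smooth on `M × [0, ∞)` solving `∂ₜu = Δ_g u − g⁻¹(dV, du)` with values in `[a, b]`, `a > 0`,
bounded `Lu` and `|∇u|²`, and `e^{-V} ∈ L¹(dV_g)`:

* `continuousOn_entropy_complete` — `H(t) = ∫ u log u e^{-V} dV_g` is continuous on `[0, ∞)`;
* `hasDerivAt_entropy_complete` — **`H'(t) = −I(t) = −∫ |∇u|²/u e^{-V} dV_g`** for `t > 0`: the Leibniz
  rule with the integrable bound `sup|Lu| (1 + sup|log u|) e^{-V}`, `∂ₜ(u log u) = (Lu)(1 + log u)`, and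
  Green's identity on the complete manifold (`integral_mul_weightedLaplacian_complete`).

This replaces `hasDerivAt_entropy` of the closed case (`BakryEmeryHeatFlow.lean`). Theorems only.

## References

* [BakryGentilLedoux2014] D. Bakry, I. Gentil, M. Ledoux, Springer 2014, Prop. 5.7.1 (proof, p. 268).
  READ (held text).
* [CarrilloNi2009] J. A. Carrillo, L. Ni, Comm. Anal. Geom. 17 (2009), §3, (3.2).
-/

noncomputable section

open Bundle Set Function Filter Manifold MeasureTheory
open scoped Manifold ContDiff Topology ENNReal NNReal

namespace Literature.Geometry.Riemannian

open Lorentzian Lorentzian.PseudoRiemannianMetric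

universe uM

section Flow

variable {n : ℕ} {M : Type uM} [TopologicalSpace M] [T2Space M] [SecondCountableTopology M]
  [ChartedSpace (EuclideanSpace ℝ (Fin n)) M] [IsManifold (𝓡 n) ∞ M] [ConnectedSpace M]
  [T3Space M] [MeasurableSpace M] [BorelSpace M]
  {g : PseudoRiemannianMetric (𝓡 n) ∞ (EuclideanSpace ℝ (Fin n)) (TangentSpace (𝓡 n) : M → Type _)}
  [g.HasLeviCivita]

omit [T2Space M] [SecondCountableTopology M] [ConnectedSpace M] [g.HasLeviCivita] in
/-- **The entropy is continuous on `[0, ∞)`** along a family `u` jointly smooth on `M × [0, ∞)` with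
values in `[a, b]`, `a > 0` (dominated convergence, finite weighted volume). [folklore] -/
theorem continuousOn_entropy_complete {V : M → ℝ} (hV : ContMDiff (𝓡 n) 𝓘(ℝ, ℝ) ∞ V)
    (hw : Integrable (fun x ↦ Real.exp (-V x)) g.riemVolume) {u : ℝ → M → ℝ}
    (hu : ContMDiffOn ((𝓡 n).prod 𝓘(ℝ, ℝ)) 𝓘(ℝ, ℝ) ∞ (fun p : M × ℝ ↦ u p.2 p.1) (univ ×ˢ Ici 0))
    {a b : ℝ} (ha : 0 < a) (hab : ∀ t ∈ Ici (0 : ℝ), ∀ x, a ≤ u t x ∧ u t x ≤ b) :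
    ContinuousOn (fun s ↦ ∫ x, u s x * Real.log (u s x) * Real.exp (-V x) ∂g.riemVolume) (Ici 0) := by
  have hwc : Continuous fun x ↦ Real.exp (-V x) := Real.continuous_exp.comp hV.continuous.neg
  have hw0 : ∀ x, 0 ≤ Real.exp (-V x) := fun x ↦ (Real.exp_pos _).le
  have hslice : ∀ s ∈ Ici (0 : ℝ), ContMDiff (𝓡 n) 𝓘(ℝ, ℝ) ∞ (u s) := fun s hs ↦
    hu.comp_contMDiff (contMDiff_id.prodMk contMDiff_const) fun y ↦ ⟨mem_univ _, hs⟩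
  refine continuousOn_of_dominated (bound := fun x ↦ max |a| |b| * max |Real.log a| |Real.log b| *
    Real.exp (-V x)) (fun s hs ↦ ?_) (fun s hs ↦ Eventually.of_forall fun x ↦ ?_) (hw.const_mul _)
    (Eventually.of_forall fun x ↦ ?_)
  · have hpos : ∀ y, u s y ≠ 0 := fun y ↦ (ha.trans_le (hab s hs y).1).ne'
    exact (((hslice s hs).continuous.mul ((hslice s hs).continuous.log hpos)).mul hwc).aestronglyMeasurable
  · rw [Real.norm_eq_abs, abs_mul, abs_mul, abs_of_nonneg (hw0 x)]
    exact mul_le_mul_of_nonneg_right (mul_le_mul (abs_le_max_abs_abs (hab s hs x).1 (hab s hs x).2)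
      (abs_le_max_abs_abs (Real.log_le_log ha (hab s hs x).1)
      (Real.log_le_log (ha.trans_le (hab s hs x).1) (hab s hs x).2)) (abs_nonneg _)
      (le_trans (abs_nonneg _) (le_max_left _ _))) (hw0 x)
  · -- `s ↦ u s x` is continuous on `[0, ∞)`
    have hι : ContMDiff 𝓘(ℝ, ℝ) ((𝓡 n).prod 𝓘(ℝ, ℝ)) ∞ (fun s : ℝ ↦ (x, s)) :=
      contMDiff_const.prodMk contMDiff_id
    have hcomp : ContMDiffOn 𝓘(ℝ, ℝ) 𝓘(ℝ, ℝ) ∞ (fun s ↦ u s x) (Ici 0) :=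
      hu.comp hι.contMDiffOn fun s hs ↦ ⟨mem_univ _, hs⟩
    have hcu : ContinuousOn (fun s ↦ u s x) (Ici 0) := hcomp.continuousOn
    have hpos : ∀ s ∈ Ici (0 : ℝ), u s x ≠ 0 := fun s hs ↦ (ha.trans_le (hab s hs x).1).ne'
    exact (hcu.mul (hcu.log hpos)).mul continuousOn_const

/-- **The entropy dissipates at the rate of the Fisher information on a complete manifold:
`dH/dt = −I`** (de Bruijn's identity `d/dt Ent_μ(P_t f) = −I_μ(P_t f)`,
Bakry–Gentil–Ledoux 2014, proof of Prop. 5.7.1; Carrillo–Ni 2009, (3.2)). For `u` jointly smooth on `M × [0, ∞)`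
solving `∂ₜu = Δ_g u − g⁻¹(dV, du)` with values in `[a, b]`, `a > 0`, with `Lu` and `|∇u|²` bounded on
`M × [0, ∞)`, on a complete manifold with `e^{-V} ∈ L¹`: `H(t) = ∫ u log u e^{-V}` has derivative
`−I(t) = −∫ |∇u|²/u e^{-V}` at every `t > 0` (Leibniz rule with an integrable bound,
`∂ₜ(u log u) = (Lu)(1 + log u)`, and Green's identity on the complete manifold
`∫ (Lu)(1 + log u) e^{-V} = −∫ |∇u|²/u e^{-V}`). [cite: BakryGentilLedoux2014, Prop. 5.7.1 (proof, p. 268)]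
[cite: CarrilloNi2009, §3, (3.2)] -/
theorem hasDerivAt_entropy_complete (hg : g.IsRiemannian)
    (hc : ∀ (x : M) (r : NNReal), IsCompact {y : M | g.edist hg x y ≤ r})
    {V : M → ℝ} (hV : ContMDiff (𝓡 n) 𝓘(ℝ, ℝ) ∞ V) (hw : Integrable (fun x ↦ Real.exp (-V x)) g.riemVolume)
    {u : ℝ → M → ℝ}
    (hu : ContMDiffOn ((𝓡 n).prod 𝓘(ℝ, ℝ)) 𝓘(ℝ, ℝ) ∞ (fun p : M × ℝ ↦ u p.2 p.1) (univ ×ˢ Ici 0))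
    (heq : ∀ t ∈ Ici (0 : ℝ), ∀ x, derivWithin (fun s ↦ u s x) (Ici 0) t =
      g.dalembertian (u t) x - g.innerDual x (mvfderiv (𝓡 n) V x : TangentSpace (𝓡 n) x →ₗ[ℝ] ℝ)
        (mvfderiv (𝓡 n) (u t) x : TangentSpace (𝓡 n) x →ₗ[ℝ] ℝ))
    {a b : ℝ} (ha : 0 < a) (hab : ∀ t ∈ Ici (0 : ℝ), ∀ x, a ≤ u t x ∧ u t x ≤ b)
    {CL : ℝ} (hLu : ∀ t ∈ Ici (0 : ℝ), ∀ x, |g.dalembertian (u t) x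
      - g.innerDual x (mvfderiv (𝓡 n) V x : TangentSpace (𝓡 n) x →ₗ[ℝ] ℝ)
          (mvfderiv (𝓡 n) (u t) x : TangentSpace (𝓡 n) x →ₗ[ℝ] ℝ)| ≤ CL)
    {CG : ℝ} (hGu : ∀ t ∈ Ici (0 : ℝ), ∀ x, g.gradSq (u t) x ≤ CG) {t : ℝ} (ht : 0 < t) :
    HasDerivAt (fun s ↦ ∫ x, u s x * Real.log (u s x) * Real.exp (-V x) ∂g.riemVolume)
      (-∫ x, g.gradSq (u t) x / u t x * Real.exp (-V x) ∂g.riemVolume) t := by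
  set w : M → ℝ := fun x ↦ Real.exp (-V x) with hwdef
  have hwc : Continuous w := Real.continuous_exp.comp hV.continuous.neg
  have hw0 : ∀ x, 0 ≤ w x := fun x ↦ (Real.exp_pos _).le
  have hV1 : ContMDiff (𝓡 n) 𝓘(ℝ, ℝ) 1 V := hV.of_le (by norm_num)
  have hslice : ∀ s ∈ Ici (0 : ℝ), ContMDiff (𝓡 n) 𝓘(ℝ, ℝ) ∞ (u s) := fun s hs ↦
    hu.comp_contMDiff (contMDiff_id.prodMk contMDiff_const) fun y ↦ ⟨mem_univ _, hs⟩
  have hpos : ∀ s ∈ Ici (0 : ℝ), ∀ y, 0 < u s y := fun s hs y ↦ ha.trans_le (hab s hs y).1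
  set Clog : ℝ := max |Real.log a| |Real.log b| with hClog
  -- notation for `L(u s)`
  set Lu : ℝ → M → ℝ := fun s x ↦ g.dalembertian (u s) x
      - g.innerDual x (mvfderiv (𝓡 n) V x : TangentSpace (𝓡 n) x →ₗ[ℝ] ℝ)
          (mvfderiv (𝓡 n) (u s) x : TangentSpace (𝓡 n) x →ₗ[ℝ] ℝ) with hLudef
  have hLuc : ∀ s ∈ Ici (0 : ℝ), Continuous (Lu s) := fun s hs ↦
    (continuous_dalembertian g ((hslice s hs).of_le (WithTop.coe_le_coe.mpr le_top))).sub
      (continuous_innerDual_mvfderiv g hV1 ((hslice s hs).of_le (by norm_num)))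
  -- the Leibniz rule
  set F : ℝ → M → ℝ := fun s x ↦ u s x * Real.log (u s x) * w x with hFdef
  set F' : ℝ → M → ℝ := fun s x ↦
    derivWithin (fun r ↦ u r x) (Ici 0) s * (Real.log (u s x) + 1) * w x with hF'def
  have hmain := hasDerivAt_integral_of_dominated_loc_of_deriv_le (μ := g.riemVolume) (F := F)
    (F' := F') (x₀ := t) (s := Ioi 0) (bound := fun x ↦ CL * (Clog + 1) * w x) (Ioi_mem_nhds ht)
    ?_ ?_ ?_ ?_ (hw.const_mul _) ?_
  rotate_left
  · -- measurability of `F s` near `t`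
    filter_upwards [Ioi_mem_nhds ht] with s hs
    have hs' : s ∈ Ici (0 : ℝ) := mem_Ici.2 (le_of_lt (mem_Ioi.1 hs))
    exact (((hslice s hs').continuous.mul ((hslice s hs').continuous.log
      fun y ↦ (hpos s hs' y).ne')).mul hwc).aestronglyMeasurable
  · -- integrability of `F t`
    have ht' : t ∈ Ici (0 : ℝ) := le_of_lt ht
    refine integrable_mul_weight ((hslice t ht').continuous.mul ((hslice t ht').continuous.log
      fun y ↦ (hpos t ht' y).ne')) ⟨max |a| |b| * Clog, fun x ↦ ?_⟩ hw
    rw [abs_mul]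
    exact mul_le_mul (abs_le_max_abs_abs (hab t ht' x).1 (hab t ht' x).2)
      (abs_le_max_abs_abs (Real.log_le_log ha (hab t ht' x).1)
      (Real.log_le_log (ha.trans_le (hab t ht' x).1) (hab t ht' x).2)) (abs_nonneg _)
      (le_trans (abs_nonneg _) (le_max_left _ _))
  · -- measurability of `F' t`
    have ht' : t ∈ Ici (0 : ℝ) := le_of_lt ht
    have hF't : F' t = fun x ↦ Lu t x * (Real.log (u t x) + 1) * w x := by
      funext x; simp only [hF'def, hLudef, heq t ht' x]
    rw [hF't]
    exact (((hLuc t ht').mul (((hslice t ht').continuous.log fun y ↦ (hpos t ht' y).ne').add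
      continuous_const)).mul hwc).aestronglyMeasurable
  · -- the bound on `F' s`, `s > 0`
    refine Eventually.of_forall fun x s hs ↦ ?_
    have hs' : s ∈ Ici (0 : ℝ) := mem_Ici.2 (le_of_lt (mem_Ioi.1 hs))
    simp only [hF'def, heq s hs' x]
    rw [Real.norm_eq_abs, abs_mul, abs_mul, abs_of_nonneg (hw0 x)]
    refine mul_le_mul_of_nonneg_right (mul_le_mul (hLu s hs' x) ((abs_add_le _ _).trans
      (add_le_add (abs_le_max_abs_abs (Real.log_le_log ha (hab s hs' x).1)
      (Real.log_le_log (ha.trans_le (hab s hs' x).1) (hab s hs' x).2)) (by norm_num)))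
      (abs_nonneg _) ((abs_nonneg _).trans (hLu s hs' x))) (hw0 x)
  · -- differentiability in time, `s > 0`
    refine Eventually.of_forall fun x s hs ↦ ?_
    have hs' : s ∈ Ici (0 : ℝ) := mem_Ici.2 (le_of_lt (mem_Ioi.1 hs))
    have hd : HasDerivAt (fun r ↦ u r x) (derivWithin (fun r ↦ u r x) (Ici 0) s) s :=
      (hasDerivWithinAt_time_of_contMDiffOn (k := ∞) (by simp) hu x hs').hasDerivAt
        (Ici_mem_nhds hs)
    have hne : u s x ≠ 0 := (hpos s hs' x).ne'
    have h1 := ((hd.mul (hd.log hne)).mul_const (w x))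
    refine h1.congr_deriv ?_
    simp only [hF'def]
    field_simp
  -- the value of the derivative: Green's identity on the complete manifold
  have ht' : t ∈ Ici (0 : ℝ) := le_of_lt ht
  refine hmain.2.congr_deriv ?_
  have hut : ContMDiff (𝓡 n) 𝓘(ℝ, ℝ) ∞ (u t) := hslice t ht'
  have hut1 : ContMDiff (𝓡 n) 𝓘(ℝ, ℝ) 1 (u t) := hut.of_le (by norm_num)
  have hut2 : ContMDiff (𝓡 n) 𝓘(ℝ, ℝ) 2 (u t) := hut.of_le (WithTop.coe_le_coe.mpr le_top)
  have hne : ∀ x, u t x ≠ 0 := fun x ↦ (hpos t ht' x).ne'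
  -- `a = log u + 1`
  have ha1 : ContMDiff (𝓡 n) 𝓘(ℝ, ℝ) 1 (fun x ↦ Real.log (u t x) + 1) := fun x ↦
    (((Real.contDiffAt_log.2 (hne x)).of_le le_top).comp_contMDiffAt (hut1 x)).add contMDiffAt_const
  have hda : ∀ x, (mvfderiv (𝓡 n) (fun x ↦ Real.log (u t x) + 1) x : TangentSpace (𝓡 n) x →ₗ[ℝ] ℝ) =
      (u t x)⁻¹ • (mvfderiv (𝓡 n) (u t) x : TangentSpace (𝓡 n) x →ₗ[ℝ] ℝ) := by
    intro x
    have hh : HasDerivAt (fun r : ℝ ↦ Real.log r + 1) ((u t x)⁻¹) (u t x) := by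
      simpa using (Real.hasDerivAt_log (hne x)).add_const (1 : ℝ)
    ext v
    simp only [ContinuousLinearMap.coe_coe, LinearMap.smul_apply, smul_eq_mul]
    exact mvfderiv_real_comp_apply (h := fun r : ℝ ↦ Real.log r + 1) hh
      (hut1.mdifferentiableAt one_ne_zero) v
  have hgrada : ∀ x, g.gradSq (fun x ↦ Real.log (u t x) + 1) x = ((u t x)⁻¹) ^ 2 * g.gradSq (u t) x := by
    intro x
    have hh : HasDerivAt (fun r : ℝ ↦ Real.log r + 1) ((u t x)⁻¹) (u t x) := by
      simpa using (Real.hasDerivAt_log (hne x)).add_const (1 : ℝ)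
    exact g.gradSq_real_comp (h := fun r : ℝ ↦ Real.log r + 1) hh (hut1.mdifferentiableAt one_ne_zero)
  have haC : ∃ C, ∀ x, |Real.log (u t x) + 1| ≤ C := ⟨Clog + 1, fun x ↦ (abs_add_le _ _).trans
    (add_le_add (abs_le_max_abs_abs (Real.log_le_log ha (hab t ht' x).1)
      (Real.log_le_log (ha.trans_le (hab t ht' x).1) (hab t ht' x).2)) (by norm_num))⟩
  have hdaC : ∃ C, ∀ x, g.gradSq (fun x ↦ Real.log (u t x) + 1) x ≤ C := by
    refine ⟨(a⁻¹) ^ 2 * CG, fun x ↦ ?_⟩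
    rw [hgrada x]
    have h1 : (u t x)⁻¹ ≤ a⁻¹ := (inv_le_inv₀ (hpos t ht' x) ha).2 (hab t ht' x).1
    have h2 : 0 ≤ (u t x)⁻¹ := inv_nonneg.2 (hpos t ht' x).le
    exact mul_le_mul (pow_le_pow_left₀ h2 h1 2) (hGu t ht' x) (g.gradSq_nonneg hg _ x) (sq_nonneg _)
  have hGreen := integral_mul_weightedLaplacian_complete hg hc ha1 hut2 hV1 hw haC hdaC
    ⟨CG, hGu t ht'⟩ ⟨CL, hLu t ht'⟩
  have hL : ∫ x, F' t x ∂g.riemVolume = ∫ x, (Real.log (u t x) + 1) * (g.dalembertian (u t) x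
      - g.innerDual x (mvfderiv (𝓡 n) V x : TangentSpace (𝓡 n) x →ₗ[ℝ] ℝ)
          (mvfderiv (𝓡 n) (u t) x : TangentSpace (𝓡 n) x →ₗ[ℝ] ℝ)) * Real.exp (-V x)
      ∂g.riemVolume := by
    refine integral_congr_ae (Eventually.of_forall fun x ↦ ?_)
    simp only [hF'def, heq t ht' x, hwdef]
    ring
  have hR : ∫ x, g.innerDual x (mvfderiv (𝓡 n) (fun x ↦ Real.log (u t x) + 1) x :
      TangentSpace (𝓡 n) x →ₗ[ℝ] ℝ) (mvfderiv (𝓡 n) (u t) x : TangentSpace (𝓡 n) x →ₗ[ℝ] ℝ)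
        * Real.exp (-V x) ∂g.riemVolume =
      ∫ x, g.gradSq (u t) x / u t x * Real.exp (-V x) ∂g.riemVolume := by
    refine integral_congr_ae (Eventually.of_forall fun x ↦ ?_)
    dsimp only
    rw [hda x, g.innerDual_smul_left]
    rw [show g.innerDual x (mvfderiv (𝓡 n) (u t) x : TangentSpace (𝓡 n) x →ₗ[ℝ] ℝ)
      (mvfderiv (𝓡 n) (u t) x : TangentSpace (𝓡 n) x →ₗ[ℝ] ℝ) = g.gradSq (u t) x from rfl]
    rw [div_eq_inv_mul]
  rw [hL, hGreen, hR]

end Flow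

end Literature.Geometry.Riemannian

end
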